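import Literature.MathematicalPhysics.QuantumFieldTheory.Balaban1983to89.B2Eq234Exponent

/-!
# `Balaban1983to89.B2Eq234SecondRepr` — [Balaban1982Higgs2] (2.34) p. 564, part 2 of 3: the second representation of
`ρ″^{(1),L}(Λ₀, B, θ₁B^{(1)}, ψ)` *"obtained by integration with respect to A↾_{Λ₅}, φ↾_{Λ₅}"* (p. 565) — PROVED as an
identity of integrals for the finite-dimensional Gaussian model (one field species: `secondRepr`; both species, the printed
double integral `∫dA∫dφ`: `secondRepr_pair`), and (2.30) p. 563 in components (`display230`)

statement-level skeleton of published theorems with citation tags; proofs where landed; nothing here is a claim about the Yang–Mills mass gap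

PDF held: `paper:balaban1982-cmp86-higgs23-ii` (T. Bałaban, *(Higgs)₂,₃ quantum fields in a finite volume. II. An upper
bound*, Commun. Math. Phys. **86** (1982) 555–594, doi 10.1007/bf01214890; journal page = PDF page + 554); pp. 563–565
[PDF 9–11] READ AS IMAGES on the ×2 renders
`run/shared/lean/pub/pub-balaban/b2b-balaban-ref1/pages/1982-cmp86-higgs23-II/1982-cmp86-higgs23-II-p009-x2.png` … `-p011-x2.png`.

CITATION HEADER — WHAT IS REPRODUCED.  SKELETON row **B2.Eq2.42** ((2.20)–(2.42)), member **(2.34)** p. 564 and the rider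
**(2.30)** p. 563; the printed text of (2.34), the model dictionary (`S`, `p`, `T`, `pT`, `Qm`, `κ`, `D`, `mainOp`, `cov`,
`st`, `u_b`) and the two exponents `firstExp`/`secondExp` with the pointwise identity `exponent_identity` are in part 1,
`…B2Eq234Exponent` (same unit); the vector-field/lattice instance with every hypothesis discharged is part 3,
`…B2Eq234Lattice`.  Unit `lit-balaban-p15` gen 3 (Phase-2 proof seat p15; HOME `run/shared/lean/pub/lit-balaban/`, seat dir
`lit-balaban-p15/`); B2 fold owner r02, second reader r14; referee ref-4.

WHAT IS KERNEL-CHECKED (zero `sorry`, standard axioms).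
 §1 `integral_fiber`, `integral_out` — (2.28) with `F ≡ 1`, the `Λ`-integral EVALUATED: `∫dφ e^{−½⟨φ,𝒜φ⟩}e^{⟨f,φ⟩}G(φ↾_{Λᶜ})
    = ∫dφ↾_Λ e^{−½⟨φ↾_Λ,𝒜_Λφ↾_Λ⟩} · ∫dy G(y)K(y)`, `K = …B2Eq228Conditioning.secConst` (Fubini over `(φ↾_Λ, φ↾_{Λᶜ})`,
    completion of the square, translation of `dφ↾_Λ` — p. 565: *"obtained by integration with respect to A↾_{Λ₅}, φ↾_{Λ₅}"*),
    for every measurable weight with the left side absolutely convergent (`integrable_weight_source_mul`: bounded `G`);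
 §2 **(2.34), one species**: `secondRepr_of_integrable` / **`secondRepr`** —
    `∫dA G(A↾_{Λ₅ᶜ}) exp[−½κΣ_t|B_t − (QA)_t|² − ½⟨A, DA⟩] = ∫dA↾_{Λ₅ᶜ} G(A↾_{Λ₅ᶜ}) exp[secondExp(B, A↾_{Λ₅ᶜ})]
    · ∫dA↾_{Λ₅} exp(−½⟨A, (C^{(0)}_{Λ₅})⁻¹A⟩)` for `𝒜 = D + κQ*Q` positive definite, `Λ₅` a union of blocks, the boundary
    couplings of `D` supported on `st`, `G` bounded measurable (resp. the left side absolutely convergent); `norm234_eq`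
    (the last factor `= √(2π)^{|Λ₅|}/√det 𝒜↾_{Λ₅}`, p. 565 *"equal to the factors Z^{(0),ε} … calculated on the set Λ₅"*);
    `exp_secondExp`, `measurable_exp_secondExp`, `integrable_secondExp` (the right side converges absolutely);
 §3 **(2.30)** `display230`: `(φ′ − 𝒜_Λ⁻¹𝒜φ↾_{Λᶜ})(i) = φ′(i) + Σ_{b∈st} C^{(0)}_{Λ₅}(i, b₋)·u_b·φ(b₊)` for couplings
    `𝒜(b₋, b₊) = −u_b` (`u_b` = an entry of `U(B^{(1)}_b)`; `u ≡ 1` is (2.29), `…B2Eq228Conditioning.display229`);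
 §4 **(2.34), both species, as printed** — `secondRepr_pair`: `∫dA∫dφ G(A↾_{Λ₅ᶜ}, φ↾_{Λ₅ᶜ}) e^{firstExp(B,A)}e^{firstExp′(ψ,φ)}
    = ∫dA↾_{Λ₅ᶜ}∫dφ↾_{Λ₅ᶜ} G e^{secondExp(B,·)}e^{secondExp′(ψ,·)} · ∫dA↾_{Λ₅}e^{−½⟨A,(C^{(0)}_{Λ₅})⁻¹A⟩} · ∫dφ↾_{Λ₅}e^{−½⟨φ,(C^{(0)}_{Λ₅}(B^{(1)}))⁻¹φ⟩}`
    for a bounded jointly measurable weight `G` ↤ `ζ_{Λ₀}χ_{Λ₋₁∩Λ₅ᶜ}` (the `A`-species data `S, p, T, pT, κ, Qm, D, st` and the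
    `φ`-species data `S′, p′, T′, pT′, κ′, Qm′, D′, st′` independent; iterated integrals as printed).
HONEST SCOPE as in part 1: the sets, cut-offs and characteristic functions are not constructed; `χ₁` (a function of `B, ψ`
only) is a constant factor on both sides and is omitted.
-/

open MeasureTheory Matrix Finset
open scoped BigOperators

namespace Literature.MathematicalPhysics.QuantumFieldTheory.Balaban1983to89.B2Eq234SecondRepr

open B2Eq228Conditioning B2Eq234Exponent
open B13GaugeDevices (gaussWeight gaussInt gaussNorm)

variable {S : Type} [Fintype S] (p : S → Prop) [DecidablePred p] [DecidableEq S]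

/-! ## §1 Integrating out the `Λ`-variables at a weight `G(φ↾_{Λᶜ})`: (2.28) with `F ≡ 1`, evaluated -/

/-- The `y`-constant of `…B2Eq228Conditioning.integral_section` through `C^{(0)}_Λ`:
`K(y) = exp(c(y) + ½⟨j(y), C^{(0)}_Λ j(y)⟩)`. [folklore] [cite: Balaban1982Higgs2, (2.28) p.563] -/
theorem secConst_eq (𝒜 : Matrix S S ℝ) (f : S → ℝ) (y : Out p → ℝ) :
    secConst p 𝒜 f y
      = Real.exp (cOut p 𝒜 f y + 1 / 2 * (jIn p 𝒜 f y ⬝ᵥ (cov p 𝒜 *ᵥ jIn p 𝒜 f y))) := by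
  rw [secConst, cov, Real.exp_add]

/-- `K` depends continuously on the exterior field. [folklore] [cite: Balaban1982Higgs2, (2.28) p.563] -/
theorem continuous_secConst (𝒜 : Matrix S S ℝ) (f : S → ℝ) : Continuous (secConst p 𝒜 f) := by
  unfold secConst cOut jIn
  fun_prop

/-- **The fibre integral**: at fixed exterior field `y`, `∫dx e^{−½⟨φ,𝒜φ⟩}e^{⟨f,φ⟩}·c` over `φ = (x on Λ, y on Λᶜ)` equals
`∫dφ↾_Λ e^{−½⟨φ↾_Λ, 𝒜_Λφ↾_Λ⟩} · c·K(y)` (completion of the square + translation of `dφ↾_Λ`, `𝒜` positive definite).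
[cite: Balaban1982Higgs2, (2.34) p.564] -/
theorem integral_fiber (𝒜 : Matrix S S ℝ) (f : S → ℝ) (h𝒜 : 𝒜.PosDef) (y : Out p → ℝ) (c : ℝ) :
    ∫ x, weight 𝒜 (glue p x y) * (source f (glue p x y) * c)
      = gaussNorm (blkIn p 𝒜) * (c * secConst p 𝒜 f y) := by
  have hAs : 𝒜.IsSymm := isSymm_of_posDef h𝒜
  have hdet : IsUnit (blkIn p 𝒜).det := isUnit_iff_ne_zero.2 (posDef_blkIn p h𝒜).det_pos.ne'
  have h1 : (∫ x, weight 𝒜 (glue p x y) * (source f (glue p x y) * c))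
      = ∫ x, weight 𝒜 (glue p x y) * (source f (glue p x y) * (fun _ : In p → ℝ => c) x * 1) := by
    simp only [mul_one]
  rw [h1, integral_section p 𝒜 f hAs hdet y (fun _ => c) 1]
  simp only [gaussInt, smul_eq_mul, integral_mul_const, gaussNorm]
  ring

/-- **Integrating out `φ↾_Λ`** ((2.28) with `F ≡ 1`, the `Λ`-integral evaluated): for `𝒜` positive definite, a source
`f` and a weight `G` of `φ↾_{Λᶜ}` with `e^{−½⟨φ,𝒜φ⟩}e^{⟨f,φ⟩}G(φ↾_{Λᶜ})` absolutely convergent,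
`∫Π_{x∈Ω}dφ(x) e^{−½⟨φ,𝒜φ⟩}e^{⟨f,φ⟩}G(φ↾_{Λᶜ}) = ∫dφ↾_Λ e^{−½⟨φ↾_Λ, 𝒜_Λφ↾_Λ⟩} · ∫dy G(y)K(y)` with
`K(y) = exp(−½⟨y, 𝒜_{ΛᶜΛᶜ}y⟩ + ⟨f↾_{Λᶜ}, y⟩ + ½⟨𝒜_{ΛΛᶜ}y − f↾_Λ, 𝒜_Λ⁻¹(𝒜_{ΛΛᶜ}y − f↾_Λ)⟩)` — Fubini over
`φ = (φ↾_Λ, φ↾_{Λᶜ})` and `integral_fiber` (p. 565: *"obtained by integration with respect to A↾_{Λ₅}, φ↾_{Λ₅}"*).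
[cite: Balaban1982Higgs2, (2.34) p.564] -/
theorem integral_out (𝒜 : Matrix S S ℝ) (f : S → ℝ) (h𝒜 : 𝒜.PosDef) {G₀ : (Out p → ℝ) → ℝ}
    (hint : Integrable fun φ : S → ℝ => weight 𝒜 φ * (source f φ * G₀ (resOut p φ))) :
    ∫ φ, weight 𝒜 φ * (source f φ * G₀ (resOut p φ))
      = gaussNorm (blkIn p 𝒜) * ∫ y, G₀ y * secConst p 𝒜 f y := by
  set Φ : (In p → ℝ) × (Out p → ℝ) → ℝ :=
    fun q => weight 𝒜 (glue p q.1 q.2) * (source f (glue p q.1 q.2) * G₀ q.2) with hΦdef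
  have eL : (∫ φ, weight 𝒜 φ * (source f φ * G₀ (resOut p φ))) = ∫ q, Φ q := by
    rw [integral_eq_integral_glue p]
    simp only [hΦdef, resOut_glue]
  have hΦ : Integrable Φ := by
    have h := (integrable_iff_integrable_glue p _).1 hint
    simpa only [hΦdef, resOut_glue] using h
  have hinner : ∀ y, (∫ x, Φ (x, y)) = gaussNorm (blkIn p 𝒜) * (G₀ y * secConst p 𝒜 f y) := by
    intro y
    simp only [hΦdef]
    exact integral_fiber p 𝒜 f h𝒜 y (G₀ y)
  have e2 : ∫ q, Φ q = ∫ y, ∫ x, Φ (x, y) := integral_prod_symm Φ hΦ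
  rw [eL, e2]
  simp_rw [hinner]
  rw [integral_const_mul]

omit [DecidablePred p] in
/-- For a BOUNDED measurable weight `G` (the print's case: products of characteristic functions, p. 564) the left side
of `integral_out` converges absolutely. [cite: Balaban1982Higgs2, (2.34) p.564] -/
theorem integrable_weight_source_mul (𝒜 : Matrix S S ℝ) (f : S → ℝ) (h𝒜 : 𝒜.PosDef) {G₀ : (Out p → ℝ) → ℝ}
    (hG : Measurable G₀) {CG : ℝ} (hGb : ∀ y, |G₀ y| ≤ CG) :
    Integrable fun φ : S → ℝ => weight 𝒜 φ * (source f φ * G₀ (resOut p φ)) := by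
  have hws := integrable_weight_mul_source 𝒜 f h𝒜
  have hm : AEStronglyMeasurable (fun φ : S → ℝ => G₀ (resOut p φ)) volume :=
    (hG.comp (measurable_resOut p)).aestronglyMeasurable
  have hb : ∀ᵐ φ : S → ℝ ∂volume, ‖G₀ (resOut p φ)‖ ≤ CG :=
    Filter.Eventually.of_forall fun φ => by
      rw [Real.norm_eq_abs]
      exact hGb _
  have h := hws.bdd_mul hm hb
  refine h.congr (Filter.Eventually.of_forall fun φ => ?_)
  show G₀ (resOut p φ) * (weight 𝒜 φ * source f φ) = _
  ring

/-! ## §2 **(2.34)**: the second representation by integrating out `A↾_{Λ₅}` (resp. `φ↾_{Λ₅}`) -/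

variable {T : Type} [Fintype T] (pT : T → Prop) [DecidablePred pT]

/-- **(2.34) p. 564, one field species, under absolute convergence**: for the main operator `𝒜 = D + κQ*Q` positive
definite, `Λ₅` a union of blocks (`hQ`), the boundary couplings of `D` supported on `st` ↤ `st(Λ₅)` (`hst`) and a
weight `G(A↾_{Λ₅ᶜ})` ↤ `ζ_{Λ₀}χ_{Λ₋₁∩Λ₅ᶜ}` (× the factors not depending on `A↾_{Λ₅}`) with `G·e^{firstExp}` absolutely
convergent:  `∫dA G(A↾_{Λ₅ᶜ}) exp[−½aL^{d−2}Σ_{y∈T′₁}|B − QA|² − ½⟨A,(−Δ+μ₀²ε²)A⟩]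
 = ∫dA↾_{Λ₅ᶜ} G(A↾_{Λ₅ᶜ}) exp[secondExp] · ∫dA↾_{Λ₅} exp(−½⟨A, (C^{(0)}_{Λ₅})⁻¹A⟩)`, `(C^{(0)}_{Λ₅})⁻¹ = 𝒜↾_{Λ₅}`
(`B2Eq234Exponent.inv_cov`) — *"The second representation in (2.34) was obtained by integration with respect to A↾_{Λ₅},
φ↾_{Λ₅}"* (p. 565). [cite: Balaban1982Higgs2, (2.34) p.564] -/
theorem secondRepr_of_integrable (κ : ℝ) (Qm : Matrix S T ℝ) (D : Matrix S S ℝ)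
    (h𝒜 : (mainOp κ Qm D).PosDef) (hQ : ∀ s t, Qm s t ≠ 0 → (p s ↔ pT t)) (st : Finset (In p × Out p))
    (hst : ∀ i j, (i, j) ∉ st → blkMix p D i j = 0) {G₀ : (Out p → ℝ) → ℝ} (B : T → ℝ)
    (hint : Integrable fun φ : S → ℝ =>
      weight (mainOp κ Qm D) φ * (source (κ • (Qm *ᵥ B)) φ * G₀ (resOut p φ))) :
    ∫ φ, G₀ (resOut p φ) * Real.exp (firstExp κ Qm D B φ)
      = (∫ y, G₀ y * Real.exp (secondExp p pT κ Qm D st B y))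
          * ∫ x, Real.exp (-(1 / 2 : ℝ) * (x ⬝ᵥ (blkIn p (mainOp κ Qm D) *ᵥ x))) := by
  have hL : (∫ φ, G₀ (resOut p φ) * Real.exp (firstExp κ Qm D B φ))
      = Real.exp (-(1 / 2 : ℝ) * κ * ∑ t, B t ^ 2)
          * ∫ φ, weight (mainOp κ Qm D) φ * (source (κ • (Qm *ᵥ B)) φ * G₀ (resOut p φ)) := by
    rw [← integral_const_mul]
    refine integral_congr_ae (Filter.Eventually.of_forall fun φ => ?_)
    show G₀ (resOut p φ) * Real.exp (firstExp κ Qm D B φ) = _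
    rw [exp_firstExp]
    ring
  have hN : (∫ x, Real.exp (-(1 / 2 : ℝ) * (x ⬝ᵥ (blkIn p (mainOp κ Qm D) *ᵥ x))))
      = gaussNorm (blkIn p (mainOp κ Qm D)) := by
    rw [gaussNorm]
    refine integral_congr_ae (Filter.Eventually.of_forall fun x => ?_)
    show Real.exp (-(1 / 2 : ℝ) * (x ⬝ᵥ (blkIn p (mainOp κ Qm D) *ᵥ x))) = gaussWeight (blkIn p (mainOp κ Qm D)) x
    rw [gaussWeight]
    congr 1
    ring
  have hpt : ∀ y, G₀ y * Real.exp (secondExp p pT κ Qm D st B y)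
      = Real.exp (-(1 / 2 : ℝ) * κ * ∑ t, B t ^ 2) * (G₀ y * secConst p (mainOp κ Qm D) (κ • (Qm *ᵥ B)) y) := by
    intro y
    rw [secConst_eq, ← exponent_identity p pT κ Qm D h𝒜 hQ st hst B y, Real.exp_add]
    ring
  rw [hL, integral_out p (mainOp κ Qm D) (κ • (Qm *ᵥ B)) h𝒜 hint, hN]
  simp_rw [hpt]
  rw [integral_const_mul]
  ring

/-- **(2.34) p. 564, one field species** — the print's case of a BOUNDED measurable weight (characteristic functions ×
bounded factors): `∫dA G(A↾_{Λ₅ᶜ}) e^{firstExp(B, A)} = ∫dA↾_{Λ₅ᶜ} G e^{secondExp(B, A↾_{Λ₅ᶜ})} · ∫dA↾_{Λ₅} e^{−½⟨A,(C^{(0)}_{Λ₅})⁻¹A⟩}`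
with no convergence hypothesis left. [cite: Balaban1982Higgs2, (2.34) p.564] -/
theorem secondRepr (κ : ℝ) (Qm : Matrix S T ℝ) (D : Matrix S S ℝ)
    (h𝒜 : (mainOp κ Qm D).PosDef) (hQ : ∀ s t, Qm s t ≠ 0 → (p s ↔ pT t)) (st : Finset (In p × Out p))
    (hst : ∀ i j, (i, j) ∉ st → blkMix p D i j = 0) {G₀ : (Out p → ℝ) → ℝ} (hG : Measurable G₀) {CG : ℝ}
    (hGb : ∀ y, |G₀ y| ≤ CG) (B : T → ℝ) :
    ∫ φ, G₀ (resOut p φ) * Real.exp (firstExp κ Qm D B φ)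
      = (∫ y, G₀ y * Real.exp (secondExp p pT κ Qm D st B y))
          * ∫ x, Real.exp (-(1 / 2 : ℝ) * (x ⬝ᵥ (blkIn p (mainOp κ Qm D) *ᵥ x))) :=
  secondRepr_of_integrable p pT κ Qm D h𝒜 hQ st hst B
    (integrable_weight_source_mul p (mainOp κ Qm D) (κ • (Qm *ᵥ B)) h𝒜 hG hGb)

/-- The normalisation integral of (2.34) is the Gaussian constant of `𝒜↾_{Λ₅}`:
`∫dA↾_{Λ₅} e^{−½⟨A,(C^{(0)}_{Λ₅})⁻¹A⟩} = √(2π)^{|Λ₅|}/√det(𝒜↾_{Λ₅})` (p. 565: *"equal to the factors Z^{(0),ε} …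
calculated on the set Λ₅"* after rescaling — `B2Eq228Conditioning.gaussNorm_eq`). [cite: Balaban1982Higgs2, (2.34) p.565] -/
theorem norm234_eq (𝒜 : Matrix S S ℝ) (h𝒜 : 𝒜.PosDef) :
    ∫ x, Real.exp (-(1 / 2 : ℝ) * (x ⬝ᵥ (blkIn p 𝒜 *ᵥ x)))
      = Real.sqrt (2 * Real.pi) ^ Fintype.card (In p) / Real.sqrt (blkIn p 𝒜).det := by
  rw [← gaussNorm_eq (posDef_blkIn p h𝒜), gaussNorm]
  refine integral_congr_ae (Filter.Eventually.of_forall fun x => ?_)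
  show Real.exp (-(1 / 2 : ℝ) * (x ⬝ᵥ (blkIn p 𝒜 *ᵥ x))) = gaussWeight (blkIn p 𝒜) x
  rw [gaussWeight]
  congr 1
  ring

/-- The second-representation integrand through the conditioning constant:
`e^{secondExp(B, y)} = e^{−½κΣ_tB_t²}·K(y)`. [cite: Balaban1982Higgs2, (2.34) p.564] -/
theorem exp_secondExp (κ : ℝ) (Qm : Matrix S T ℝ) (D : Matrix S S ℝ) (h𝒜 : (mainOp κ Qm D).PosDef)
    (hQ : ∀ s t, Qm s t ≠ 0 → (p s ↔ pT t)) (st : Finset (In p × Out p))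
    (hst : ∀ i j, (i, j) ∉ st → blkMix p D i j = 0) (B : T → ℝ) (y : Out p → ℝ) :
    Real.exp (secondExp p pT κ Qm D st B y)
      = Real.exp (-(1 / 2 : ℝ) * κ * ∑ t, B t ^ 2) * secConst p (mainOp κ Qm D) (κ • (Qm *ᵥ B)) y := by
  rw [secConst_eq, ← exponent_identity p pT κ Qm D h𝒜 hQ st hst B y, Real.exp_add]

/-- `y ↦ e^{secondExp(B, y)}` is measurable (indeed continuous). [folklore] [cite: Balaban1982Higgs2, (2.34) p.564] -/
theorem measurable_exp_secondExp (κ : ℝ) (Qm : Matrix S T ℝ) (D : Matrix S S ℝ) (h𝒜 : (mainOp κ Qm D).PosDef)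
    (hQ : ∀ s t, Qm s t ≠ 0 → (p s ↔ pT t)) (st : Finset (In p × Out p))
    (hst : ∀ i j, (i, j) ∉ st → blkMix p D i j = 0) (B : T → ℝ) :
    Measurable fun y => Real.exp (secondExp p pT κ Qm D st B y) := by
  have h : (fun y => Real.exp (secondExp p pT κ Qm D st B y))
      = fun y => Real.exp (-(1 / 2 : ℝ) * κ * ∑ t, B t ^ 2) * secConst p (mainOp κ Qm D) (κ • (Qm *ᵥ B)) y :=
    funext fun y => exp_secondExp p pT κ Qm D h𝒜 hQ st hst B y
  rw [h]
  exact (continuous_const.mul (continuous_secConst p _ _)).measurable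

/-- The right side of (2.34) converges absolutely for a bounded measurable weight: `y ↦ G(y)e^{secondExp(B, y)}` is
integrable over the exterior fields. [cite: Balaban1982Higgs2, (2.34) p.564] -/
theorem integrable_secondExp (κ : ℝ) (Qm : Matrix S T ℝ) (D : Matrix S S ℝ) (h𝒜 : (mainOp κ Qm D).PosDef)
    (hQ : ∀ s t, Qm s t ≠ 0 → (p s ↔ pT t)) (st : Finset (In p × Out p))
    (hst : ∀ i j, (i, j) ∉ st → blkMix p D i j = 0) {G₀ : (Out p → ℝ) → ℝ} (hG : Measurable G₀) {CG : ℝ}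
    (hGb : ∀ y, |G₀ y| ≤ CG) (B : T → ℝ) :
    Integrable fun y => G₀ y * Real.exp (secondExp p pT κ Qm D st B y) := by
  have hint := integrable_weight_source_mul p (mainOp κ Qm D) (κ • (Qm *ᵥ B)) h𝒜 hG hGb
  set Φ : (In p → ℝ) × (Out p → ℝ) → ℝ := fun q =>
    weight (mainOp κ Qm D) (glue p q.1 q.2) * (source (κ • (Qm *ᵥ B)) (glue p q.1 q.2) * G₀ q.2) with hΦdef
  have hΦ : Integrable Φ := by
    have h := (integrable_iff_integrable_glue p _).1 hint
    simpa only [hΦdef, resOut_glue] using h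
  have h1 : Integrable (fun y => ∫ x, Φ (x, y)) := hΦ.integral_prod_right
  have h2 : ∀ y, (∫ x, Φ (x, y))
      = gaussNorm (blkIn p (mainOp κ Qm D)) * (G₀ y * secConst p (mainOp κ Qm D) (κ • (Qm *ᵥ B)) y) := by
    intro y
    simp only [hΦdef]
    exact integral_fiber p _ _ h𝒜 y (G₀ y)
  have hN : gaussNorm (blkIn p (mainOp κ Qm D)) ≠ 0 := (gaussNorm_pos (posDef_blkIn p h𝒜)).ne'
  have h3 := h1.const_mul (Real.exp (-(1 / 2 : ℝ) * κ * ∑ t, B t ^ 2) * (gaussNorm (blkIn p (mainOp κ Qm D)))⁻¹)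
  refine h3.congr (Filter.Eventually.of_forall fun y => ?_)
  show Real.exp (-(1 / 2 : ℝ) * κ * ∑ t, B t ^ 2) * (gaussNorm (blkIn p (mainOp κ Qm D)))⁻¹ * ∫ x, Φ (x, y)
    = G₀ y * Real.exp (secondExp p pT κ Qm D st B y)
  rw [h2, exp_secondExp p pT κ Qm D h𝒜 hQ st hst B y]
  calc Real.exp (-(1 / 2 : ℝ) * κ * ∑ t, B t ^ 2) * (gaussNorm (blkIn p (mainOp κ Qm D)))⁻¹
        * (gaussNorm (blkIn p (mainOp κ Qm D)) * (G₀ y * secConst p (mainOp κ Qm D) (κ • (Qm *ᵥ B)) y))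
      = ((gaussNorm (blkIn p (mainOp κ Qm D)))⁻¹ * gaussNorm (blkIn p (mainOp κ Qm D)))
          * (G₀ y * (Real.exp (-(1 / 2 : ℝ) * κ * ∑ t, B t ^ 2)
              * secConst p (mainOp κ Qm D) (κ • (Qm *ᵥ B)) y)) := by ring
    _ = G₀ y * (Real.exp (-(1 / 2 : ℝ) * κ * ∑ t, B t ^ 2)
          * secConst p (mainOp κ Qm D) (κ • (Qm *ᵥ B)) y) := by
        rw [inv_mul_cancel₀ hN, one_mul]

/-! ## §3 (2.30) p. 563: the shift for the scalar field, in components -/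

/-- **(2.30)** p. 563, verbatim: *"and for scalar fields φ′(x) + Σ_{b∈st(Λ₅)} C^{(0)}_{Λ₅}(B^{(1)}; x, b₋)U(B^{(1)}_b)φ′(b₊),
x ∈ Λ₅. (2.30)"* — in components: if the scalar-field operator `𝒜` ↤ `−Δ_{B^{(1)}} + m²ε² + aL⁻²P(B^{(1)})` couples `Λ₅`
to `Λ₅ᶜ` only through the component pairs `b ∈ st` over the bonds `st(Λ₅)`, with couplings `𝒜(b₋, b₊) = −u_b` (`u_b` =
the corresponding entry of `U(B^{(1)}_b)`), then the shift of the conditional integration (2.28) at source `0` is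
`(φ′ − 𝒜_Λ⁻¹𝒜φ↾_{Λᶜ})(i) = φ′(i) + Σ_{b∈st} C^{(0)}_{Λ₅}(i, b₋)·u_b·φ(b₊)`, `C^{(0)}_{Λ₅} = 𝒜_{Λ₅}⁻¹` (the case `u ≡ 1` is
(2.29), `B2Eq228Conditioning.display229`). [cite: Balaban1982Higgs2, (2.30) p.563] -/
theorem display230 (𝒜 : Matrix S S ℝ) (st : Finset (In p × Out p))
    (hst : ∀ i j, (i, j) ∉ st → blkMix p 𝒜 i j = 0) (u : In p × Out p → ℝ)
    (hu : ∀ b ∈ st, blkMix p 𝒜 b.1 b.2 = -u b) (x : In p → ℝ) (y : Out p → ℝ) (i : In p) :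
    (x + condShift p 𝒜 0 y) i = x i + ∑ b ∈ st, cov p 𝒜 i b.1 * u b * y b.2 := by
  rw [shift_eq_sum_boundary p 𝒜 st hst x y i, cov]
  congr 1
  refine Finset.sum_congr rfl fun b hb => ?_
  rw [hu b hb, neg_neg]

/-! ## §4 Both species: (2.34) as the printed double integral `∫dA∫dφ` -/

section Pair

variable {S' : Type} [Fintype S'] (p' : S' → Prop) [DecidablePred p'] [DecidableEq S']
  {T' : Type} [Fintype T'] (pT' : T' → Prop) [DecidablePred pT']

/-- **(2.34) p. 564 with both field species, as printed** (`χ₁`, a function of `B, ψ` only, omitted on both sides): for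
the vector-field data (`S, p, T, pT, κ, Qm, D, st`) and the scalar-field data (`S′, p′, T′, pT′, κ′, Qm′, D′, st′`) as in
`secondRepr`, and a bounded jointly measurable weight `G(A↾_{Λ₅ᶜ}, φ↾_{Λ₅ᶜ})` ↤ `ζ_{Λ₀}χ_{Λ₋₁∩Λ₅ᶜ}`,
`∫dA∫dφ G·exp[−½aL^{d−2}Σ|B − QA|² − ½⟨A,(−Δ+μ₀²ε²)A⟩ − ½aL^{d−2}Σ|ψ − Q(B̃^{(1)})φ|² − ½⟨φ,(−Δ_{B̃^{(1)}}+m²ε²)φ⟩]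
 = ∫dA↾_{Λ₅ᶜ}∫dφ↾_{Λ₅ᶜ} G·exp[secondExp(B, A↾_{Λ₅ᶜ}) + secondExp′(ψ, φ↾_{Λ₅ᶜ})]
   · ∫dA↾_{Λ₅}exp(−½⟨A,(C^{(0)}_{Λ₅})⁻¹A⟩) · ∫dφ↾_{Λ₅}exp(−½⟨φ,(C^{(0)}_{Λ₅}(B^{(1)}))⁻¹φ⟩)` — the identity `secondRepr`
applied to the `φ`-integration at fixed `A`, then to the `A`-integration. [cite: Balaban1982Higgs2, (2.34) p.564] -/
theorem secondRepr_pair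
    (κ : ℝ) (Qm : Matrix S T ℝ) (D : Matrix S S ℝ) (h𝒜 : (mainOp κ Qm D).PosDef)
    (hQ : ∀ s t, Qm s t ≠ 0 → (p s ↔ pT t)) (st : Finset (In p × Out p))
    (hst : ∀ i j, (i, j) ∉ st → blkMix p D i j = 0)
    (κ' : ℝ) (Qm' : Matrix S' T' ℝ) (D' : Matrix S' S' ℝ) (h𝒜' : (mainOp κ' Qm' D').PosDef)
    (hQ' : ∀ s t, Qm' s t ≠ 0 → (p' s ↔ pT' t)) (st' : Finset (In p' × Out p'))
    (hst' : ∀ i j, (i, j) ∉ st' → blkMix p' D' i j = 0)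
    {G₀ : (Out p → ℝ) → (Out p' → ℝ) → ℝ} (hG : Measurable (Function.uncurry G₀)) {CG : ℝ}
    (hGb : ∀ y y', |G₀ y y'| ≤ CG) (B : T → ℝ) (ψ : T' → ℝ) :
    ∫ A, ∫ φ, G₀ (resOut p A) (resOut p' φ)
        * (Real.exp (firstExp κ Qm D B A) * Real.exp (firstExp κ' Qm' D' ψ φ))
      = (∫ y, ∫ y', G₀ y y'
          * (Real.exp (secondExp p pT κ Qm D st B y) * Real.exp (secondExp p' pT' κ' Qm' D' st' ψ y')))
        * ((∫ x, Real.exp (-(1 / 2 : ℝ) * (x ⬝ᵥ (blkIn p (mainOp κ Qm D) *ᵥ x))))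
          * ∫ x, Real.exp (-(1 / 2 : ℝ) * (x ⬝ᵥ (blkIn p' (mainOp κ' Qm' D') *ᵥ x)))) := by
  -- the scalar-species second-representation integrand `e^{secondExp′}` is measurable and integrable
  have hes_meas : Measurable fun y' => Real.exp (secondExp p' pT' κ' Qm' D' st' ψ y') :=
    measurable_exp_secondExp p' pT' κ' Qm' D' h𝒜' hQ' st' hst' ψ
  have hes_int : Integrable fun y' => Real.exp (secondExp p' pT' κ' Qm' D' st' ψ y') := by
    have h := integrable_secondExp p' pT' κ' Qm' D' h𝒜' hQ' st' hst' (G₀ := fun _ => (1 : ℝ)) measurable_const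
      (CG := 1) (fun _ => by simp) ψ
    simpa only [one_mul] using h
  -- Step 1: the φ-integration at fixed A
  have step1 : ∀ A : S → ℝ,
      (∫ φ, G₀ (resOut p A) (resOut p' φ)
          * (Real.exp (firstExp κ Qm D B A) * Real.exp (firstExp κ' Qm' D' ψ φ)))
        = Real.exp (firstExp κ Qm D B A)
          * ((∫ y', G₀ (resOut p A) y' * Real.exp (secondExp p' pT' κ' Qm' D' st' ψ y'))
            * ∫ x, Real.exp (-(1 / 2 : ℝ) * (x ⬝ᵥ (blkIn p' (mainOp κ' Qm' D') *ᵥ x)))) := by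
    intro A
    have hGA : Measurable (G₀ (resOut p A)) := hG.of_uncurry_left
    have h := secondRepr p' pT' κ' Qm' D' h𝒜' hQ' st' hst' hGA (CG := CG) (fun y' => hGb _ y') ψ
    rw [← h, ← integral_const_mul]
    refine integral_congr_ae (Filter.Eventually.of_forall fun φ => ?_)
    show G₀ (resOut p A) (resOut p' φ) * (Real.exp (firstExp κ Qm D B A) * Real.exp (firstExp κ' Qm' D' ψ φ)) = _
    ring
  -- Step 2: the exterior φ-integral as a weight of A↾_{Λ₅ᶜ}: measurable and bounded
  have hH_meas : Measurable fun y : Out p → ℝ =>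
      ∫ y', G₀ y y' * Real.exp (secondExp p' pT' κ' Qm' D' st' ψ y') := by
    have hu : StronglyMeasurable (Function.uncurry fun (y : Out p → ℝ) (y' : Out p' → ℝ) =>
        G₀ y y' * Real.exp (secondExp p' pT' κ' Qm' D' st' ψ y')) :=
      (hG.mul (hes_meas.comp measurable_snd)).stronglyMeasurable
    exact (hu.integral_prod_right (ν := volume)).measurable
  have hH_bdd : ∀ y : Out p → ℝ,
      |∫ y', G₀ y y' * Real.exp (secondExp p' pT' κ' Qm' D' st' ψ y')|
        ≤ CG * ∫ y', Real.exp (secondExp p' pT' κ' Qm' D' st' ψ y') := by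
    intro y
    rw [← Real.norm_eq_abs, ← integral_const_mul]
    refine norm_integral_le_of_norm_le (hes_int.const_mul CG) (Filter.Eventually.of_forall fun y' => ?_)
    rw [Real.norm_eq_abs, abs_mul, abs_of_pos (Real.exp_pos _)]
    exact mul_le_mul_of_nonneg_right (hGb y y') (Real.exp_pos _).le
  -- Step 3: the A-integration with that weight
  have step3 := secondRepr p pT κ Qm D h𝒜 hQ st hst
    (G₀ := fun y => (∫ y', G₀ y y' * Real.exp (secondExp p' pT' κ' Qm' D' st' ψ y'))
      * ∫ x, Real.exp (-(1 / 2 : ℝ) * (x ⬝ᵥ (blkIn p' (mainOp κ' Qm' D') *ᵥ x))))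
    (hH_meas.mul_const _)
    (CG := CG * (∫ y', Real.exp (secondExp p' pT' κ' Qm' D' st' ψ y'))
      * |∫ x, Real.exp (-(1 / 2 : ℝ) * (x ⬝ᵥ (blkIn p' (mainOp κ' Qm' D') *ᵥ x)))|)
    (fun y => by
      rw [abs_mul]
      exact mul_le_mul_of_nonneg_right (hH_bdd y) (abs_nonneg _)) B
  -- assemble
  simp_rw [step1]
  have e2 : (∫ A, Real.exp (firstExp κ Qm D B A)
        * ((∫ y', G₀ (resOut p A) y' * Real.exp (secondExp p' pT' κ' Qm' D' st' ψ y'))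
          * ∫ x, Real.exp (-(1 / 2 : ℝ) * (x ⬝ᵥ (blkIn p' (mainOp κ' Qm' D') *ᵥ x)))))
      = ∫ A, (fun y : Out p → ℝ => (∫ y', G₀ y y' * Real.exp (secondExp p' pT' κ' Qm' D' st' ψ y'))
          * ∫ x, Real.exp (-(1 / 2 : ℝ) * (x ⬝ᵥ (blkIn p' (mainOp κ' Qm' D') *ᵥ x)))) (resOut p A)
          * Real.exp (firstExp κ Qm D B A) :=
    integral_congr_ae (Filter.Eventually.of_forall fun A => by simp only; ring)
  rw [e2, step3]
  have e3 : (∫ y, (∫ y', G₀ y y' * Real.exp (secondExp p' pT' κ' Qm' D' st' ψ y'))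
        * (∫ x, Real.exp (-(1 / 2 : ℝ) * (x ⬝ᵥ (blkIn p' (mainOp κ' Qm' D') *ᵥ x))))
        * Real.exp (secondExp p pT κ Qm D st B y))
      = (∫ x, Real.exp (-(1 / 2 : ℝ) * (x ⬝ᵥ (blkIn p' (mainOp κ' Qm' D') *ᵥ x))))
        * ∫ y, ∫ y', G₀ y y'
          * (Real.exp (secondExp p pT κ Qm D st B y) * Real.exp (secondExp p' pT' κ' Qm' D' st' ψ y')) := by
    rw [← integral_const_mul]
    refine integral_congr_ae (Filter.Eventually.of_forall fun y => ?_)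
    beta_reduce
    calc (∫ y', G₀ y y' * Real.exp (secondExp p' pT' κ' Qm' D' st' ψ y'))
          * (∫ x, Real.exp (-(1 / 2 : ℝ) * (x ⬝ᵥ (blkIn p' (mainOp κ' Qm' D') *ᵥ x))))
          * Real.exp (secondExp p pT κ Qm D st B y)
        = (∫ x, Real.exp (-(1 / 2 : ℝ) * (x ⬝ᵥ (blkIn p' (mainOp κ' Qm' D') *ᵥ x))))
          * ((∫ y', G₀ y y' * Real.exp (secondExp p' pT' κ' Qm' D' st' ψ y'))
            * Real.exp (secondExp p pT κ Qm D st B y)) := by ring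
      _ = (∫ x, Real.exp (-(1 / 2 : ℝ) * (x ⬝ᵥ (blkIn p' (mainOp κ' Qm' D') *ᵥ x))))
          * ∫ y', G₀ y y' * Real.exp (secondExp p' pT' κ' Qm' D' st' ψ y')
            * Real.exp (secondExp p pT κ Qm D st B y) := by
          congr 1
          exact (integral_mul_const _ _).symm
      _ = (∫ x, Real.exp (-(1 / 2 : ℝ) * (x ⬝ᵥ (blkIn p' (mainOp κ' Qm' D') *ᵥ x))))
          * ∫ y', G₀ y y'
            * (Real.exp (secondExp p pT κ Qm D st B y) * Real.exp (secondExp p' pT' κ' Qm' D' st' ψ y')) := by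
          congr 1
          refine integral_congr_ae (Filter.Eventually.of_forall fun y' => ?_)
          beta_reduce
          ring
  rw [e3]
  ring

end Pair

end Literature.MathematicalPhysics.QuantumFieldTheory.Balaban1983to89.B2Eq234SecondRepr
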